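import Summits.Schanuel.Schanuel.Theorems.RootDecomp1KSumFormBridge01

/-!
# RootDecomp1KSumFormBridge — lens 1, generation 41 «SUM-FORM BRIDGE»: the NAMED E-side input `SumFormExpPairMeasure` (CONJECTURE / IDEA-NEEDED, Mahler's problem in sum form) ⟹ a.i. (ℓ, e^ℓ) for every real Liouville ℓ ⟹ 33364's named first open cell (ℓ_b, ℓ_b²) — a REDUCTION (K-R27′), no cell credit — EDITION 2 (+ §9 the door (T⁺⁺) as a typed SOCKET) — continuation (RootDecomp1KSumFormBridge02): §3 the ENGINE: Liouville extraction in the exponent at polynomial quality (hypothesis-free)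

(lens-1 g41 `RootDecomp1KSumFormBridge.lean` EDITION 2 [HOME/decomp-schanuel-lens-1/g41/ sha256 f8db09bf…, 1674 l; NODE L1914 / REQUEST L1915 / EDITION 2 NOTE L1923; critic VERDICT L1925 (REDUCTION of record, (ε) booking, no credit, port GO)]; port by census-1 gen 17 as
`RootDecomp1KSumFormBridge01`–`06` — see the PORT NOTE of part 01; `--supports stmt-Schanuel-33364`; a REDUCTION to an OPEN conjecture (K-R27′); rung 0.)
-/

noncomputable section

open Complex Polynomial Filter
open scoped Topology

namespace Summit.Schanuel.Schanuel.Theorems.RootDecomp1KSumFormBridge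

open Summit.Schanuel.Schanuel.Theorems.RootDecomp1KHyper
open Summit.Schanuel.Schanuel.Theorems.RootDecomp1KHyper.HyperCell
open Summit.Schanuel.Schanuel.Theorems.RootDecomp1KGeneric
open Literature.NumberTheory.Transcendental (NesterenkoWaldschmidt1996_thm_1 weilHeight₁)

variable {K : ℕ}

/-- `1 ≤ log x` for `x ≥ 3`. -/
private theorem one_le_log_of_three_le {x : ℝ} (hx : 3 ≤ x) : 1 ≤ Real.log x := by
  rw [Real.le_log_iff_exp_le (by linarith)]
  have := Real.exp_one_lt_d9
  linarith

/-! ## §3  The engine: Liouville extraction in the exponent at POLYNOMIAL quality (hypothesis-free) -/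

/-- **Polynomial-quality simultaneous approximations of the pair `(u, e^u)`** by algebraic points of
BOUNDED degree and LOGARITHMIC size: a degree budget `N₀` and size slope `c`, and for every `m` a
scale `q ≥ m`, an irreducible `f ∈ ℤ[X]` with root `β ≠ 0` and a non-zero `S ∈ ℤ[X]` with root
`α ≠ 0`, `deg S · deg f ≤ N₀`, `log M(S), log M(f) ≤ c log q`, and
`|e^u − α| + |u − β| < exp(−m log q) = q^{−m}` — the tree's `LogSqPairApprox` (Generic17) with the
log-square quality `exp(−m (log q)²)` RELAXED to polynomial quality. -/
def LiouvillePairApprox (u : ℂ) : Prop :=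
  ∃ (N₀ : ℕ) (c : ℝ), ∀ m : ℕ, ∃ q : ℕ, m ≤ q ∧ ∃ (f S : ℤ[X]) (α β : ℂ),
    Irreducible f ∧ 0 < f.natDegree ∧ S ≠ 0 ∧ aeval β f = 0 ∧ aeval α S = 0 ∧ α ≠ 0 ∧ β ≠ 0 ∧
    S.natDegree * f.natDegree ≤ N₀ ∧
    Real.log (S.map (Int.castRingHom ℂ)).mahlerMeasure ≤ c * Real.log q ∧
    Real.log (f.map (Int.castRingHom ℂ)).mahlerMeasure ≤ c * Real.log q ∧
    ‖cexp u - α‖ + ‖u - β‖ < Real.exp (-((m : ℝ) * Real.log q))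

/-- Log-square approximations are in particular polynomial-quality ones (`log q ≤ (log q)²` at `q ≥ 3`). -/
theorem LiouvillePairApprox.of_logSq {u : ℂ} (h : LogSqPairApprox u) : LiouvillePairApprox u := by
  obtain ⟨N₀, c, h⟩ := h
  refine ⟨N₀, c, fun m => ?_⟩
  obtain ⟨q, hmq, f, S, α, β, h1, h2, h3, h4, h5, h6, h7, h8, h9, h10, hdist⟩ := h (m + 3)
  refine ⟨q, by omega, f, S, α, β, h1, h2, h3, h4, h5, h6, h7, h8, h9, h10, hdist.trans_le ?_⟩
  have hq3 : (3 : ℝ) ≤ q := by exact_mod_cast (le_trans (by omega) hmq : 3 ≤ q)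
  have hlog1 : 1 ≤ Real.log q := one_le_log_of_three_le hq3
  rw [Real.exp_le_exp, neg_le_neg_iff]
  push_cast
  have hm0 : (0 : ℝ) ≤ m := Nat.cast_nonneg m
  nlinarith [mul_nonneg hm0 (by linarith : (0 : ℝ) ≤ Real.log q)]

/-- The Mahler measure of a non-zero integer polynomial (over `ℂ`) is at least `1`. -/
private theorem one_le_mahlerMeasure_int {R : ℤ[X]} (hR : R ≠ 0) :
    1 ≤ (R.map (Int.castRingHom ℂ)).mahlerMeasure := by
  refine one_le_mahlerMeasure_of_one_le_norm_leadingCoeff ?_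
  rw [Polynomial.leadingCoeff_map_of_injective (RingHom.injective_int _), eq_intCast,
    Complex.norm_intCast]
  exact_mod_cast Int.one_le_abs (Polynomial.leadingCoeff_ne_zero.mpr hR)

set_option maxHeartbeats 800000 in
/-- **ENGINE (generic form, hypothesis-free): `ℓ` Liouville, `u` at distance `|ℓ − r|` from
algebraic points `β_r` of bounded degree and logarithmic height over every rational `r`, and
`ℓ, w = e^u` algebraically dependent ⇒ polynomial-quality simultaneous approximations of `(u, e^u)`.**
Port of the tree's log-square engine `logSqPairApprox_of_dependent_gen` (lens 6, Generic18 P2) with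
the approximation budget `exp(−i (log q)²)` replaced by `exp(−i log q)`: the relation
`Σ_k G_k(ℓ) w^k = 0` is specialised at `r = p/q` (`root_package`: `A_q = specY G D p q ≠ 0`, a root
`y` with `‖w − y‖^K ≤ q^D Λ |ℓ − r|`), and the thresholds `q^D, Λ, 2^K ≤ q` are absorbed by the
polynomial budget exactly as they were by the log-square one. -/
theorem liouvillePairApprox_of_dependent_gen {ℓ : ℝ} (hℓ : Liouville ℓ) {u w : ℂ}
    (hwu : cexp u = w) (hdep : ¬ AlgebraicIndependent ℚ ![(ℓ : ℂ), w]) {dβ : ℕ} (βof : ℚ → ℂ)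
    (Cβ : ℝ) (hCβ : 0 ≤ Cβ)
    (hβ : ∀ r : ℚ, r ≠ 0 → ∃ f : ℤ[X], Irreducible f ∧ 0 < f.natDegree ∧ f.natDegree ≤ dβ ∧
      aeval (βof r) f = 0 ∧ βof r ≠ 0 ∧
      Real.log ((f.map (Int.castRingHom ℂ)).mahlerMeasure) ≤ Cβ * Real.log ((|r.num| : ℝ) + r.den))
    (hdist : ∀ r : ℚ, ‖u - βof r‖ = |ℓ - r|) :
    LiouvillePairApprox u := by
  classical
  have hℓt : Transcendental ℚ (ℓ : ℂ) := transcendental_ofReal_of_liouville hℓ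
  obtain ⟨K, G, hGK, hrel⟩ := exists_int_relation hℓt hdep
  have hK : 0 < K := relation_degree_pos hℓt hGK hrel
  have hw0 : 0 < ‖w‖ := by rw [← hwu]; exact norm_pos_iff.mpr (Complex.exp_ne_zero _)
  set D : ℕ := Finset.univ.sup fun k => (G k).natDegree with hDdef
  have hD : ∀ k, (G k).natDegree ≤ D := fun k =>
    Finset.le_sup (f := fun k => (G k).natDegree) (Finset.mem_univ k)
  obtain ⟨Λ, hΛ1, hΛ⟩ := exists_lipschitz_at (sliceAt G w) (ℓ : ℂ)
  have hRL1 : 1 ≤ relLen G := one_le_relLen G hGK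
  -- the output constants
  set A : ℝ := Real.log (|ℓ| + 2) + 1 with hA
  have hA2 : 0 ≤ Real.log (|ℓ| + 2) := Real.log_nonneg (by linarith [abs_nonneg ℓ])
  have hA1 : 1 ≤ A := by linarith
  set c : ℝ := Real.log ((K : ℝ) + 1) + Real.log (relLen G) + ((D : ℝ) + 1) * A + Cβ * A with hc
  have hlK0 : 0 ≤ Real.log ((K : ℝ) + 1) := Real.log_nonneg (by linarith [(Nat.cast_nonneg K : (0:ℝ) ≤ K)])
  have hlR0 : 0 ≤ Real.log (relLen G) := Real.log_nonneg hRL1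
  have hAc : Cβ * A ≤ c := by
    have : 0 ≤ ((D : ℝ) + 1) * A := by positivity
    linarith
  refine ⟨K * dβ, c, fun m => ?_⟩
  -- the approximation scale (all thresholds folded into one index `i`)
  obtain ⟨KM, hKM⟩ : ∃ KM : ℕ, KM = K * (m + 1) := ⟨_, rfl⟩
  obtain ⟨PK, hPK⟩ : ∃ PK : ℕ, PK = 2 ^ K := ⟨_, rfl⟩
  obtain ⟨i, hi1, hi2, hiB, hiΛ, hiP, hiw, him, hi3⟩ : ∃ i : ℕ, KM + D + 2 ≤ i ∧ m + 1 + 1 ≤ i ∧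
      denBound (G (Fin.last K)) ≤ i ∧ ⌈Λ⌉₊ ≤ i ∧ PK ≤ i ∧ ⌈1 / ‖w‖⌉₊ + 1 ≤ i ∧ m ≤ i ∧ 3 ≤ i :=
    ⟨KM + D + 2 + (m + 2) + denBound (G (Fin.last K)) + ⌈Λ⌉₊ + PK + (⌈1 / ‖w‖⌉₊ + 1) + 3,
      by omega, by omega, by omega, by omega, by omega, by omega, by omega, by omega⟩
  obtain ⟨r, hden, hne, hlt⟩ := exists_rat_den_ge_of_liouville hℓ i
  set q : ℕ := r.den with hq
  set p : ℤ := r.num with hp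
  have hqi : i ≤ q := hden
  have hq3 : 3 ≤ q := le_trans hi3 hqi
  have hq3r : (3 : ℝ) ≤ q := by exact_mod_cast hq3
  have hq0r : (0 : ℝ) < q := by linarith
  have hq1r : (1 : ℝ) ≤ q := by linarith
  set L : ℝ := Real.log q with hL
  have hL1 : 1 ≤ L := one_le_log_of_three_le hq3r
  have hL0 : 0 ≤ L := by linarith
  have hexpL : Real.exp L = q := by rw [hL, Real.exp_log hq0r]
  -- thresholds
  have hmq : m ≤ q := le_trans him hqi
  have hdenB : denBound (G (Fin.last K)) ≤ r.den := le_trans hiB hqi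
  have hΛq : Λ ≤ q := (Nat.le_ceil Λ).trans (by exact_mod_cast (le_trans hiΛ hqi : ⌈Λ⌉₊ ≤ q))
  have h2Kq : (2 : ℝ) ^ K ≤ q := by
    have : 2 ^ K ≤ q := hPK ▸ le_trans hiP hqi
    exact_mod_cast this
  have hwq : 1 / ‖w‖ < q := by
    have h1 : (⌈1 / ‖w‖⌉₊ : ℝ) + 1 ≤ q := by exact_mod_cast (le_trans hiw hqi : ⌈1 / ‖w‖⌉₊ + 1 ≤ q)
    linarith [Nat.le_ceil (1 / ‖w‖)]
  have hqw : 1 / (q : ℝ) < ‖w‖ := by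
    rw [div_lt_iff₀ hq0r]; rw [div_lt_iff₀ hw0] at hwq; linarith
  -- `|ℓ − r| < exp(−i L) ≤ 1`
  have hη : |ℓ - r| < Real.exp (-((i : ℝ) * L)) := hlt
  have hη1 : |ℓ - r| ≤ 1 := by
    refine hη.le.trans ?_
    rw [Real.exp_le_one_iff]
    have : (0 : ℝ) ≤ (i : ℝ) * L := by positivity
    linarith
  -- the root package at `r`
  obtain ⟨hS0, hSdeg, y, hy, hpow⟩ := root_package G hK hGK hD hrel hΛ r hdenB hη1
  -- size of `p`
  have hr0 : r ≠ 0 := by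
    rintro rfl
    simp [hq] at hq3
  have hrq : (r : ℝ) = (p : ℝ) / q := by rw [hp, hq]; exact Rat.cast_def r
  have habsr : |(r : ℝ)| ≤ |ℓ| + 1 := by
    have := abs_sub_abs_le_abs_sub (r : ℝ) ℓ
    rw [abs_sub_comm] at this
    linarith
  have habsp : |(p : ℝ)| ≤ (|ℓ| + 1) * q := by
    have h1 : (p : ℝ) = (r : ℝ) * q := by rw [hrq]; field_simp
    rw [h1, abs_mul, Nat.abs_cast]
    exact mul_le_mul_of_nonneg_right habsr hq0r.le
  have hpq : (|p| : ℝ) + q ≤ (|ℓ| + 2) * q := by nlinarith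
  have hpq0 : (0 : ℝ) < (|p| : ℝ) + q := by
    have : (0 : ℝ) ≤ |(p : ℝ)| := abs_nonneg _
    linarith
  have hlogpq : Real.log ((|p| : ℝ) + q) ≤ Real.log (|ℓ| + 2) + L := by
    calc Real.log ((|p| : ℝ) + q) ≤ Real.log ((|ℓ| + 2) * q) := Real.log_le_log hpq0 hpq
      _ = Real.log (|ℓ| + 2) + L := by
          rw [Real.log_mul (by linarith [abs_nonneg ℓ]) hq0r.ne', hL]
  have hlogpq' : Real.log ((|p| : ℝ) + q) ≤ A * L := by
    calc Real.log ((|p| : ℝ) + q) ≤ Real.log (|ℓ| + 2) + L := hlogpq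
      _ ≤ Real.log (|ℓ| + 2) * L + L := by nlinarith
      _ = A * L := by rw [hA]; ring
  -- the budget: `q^D · Λ · exp(−i L) · 2^K ≤ exp(−K(m+1) L)`
  set ε : ℝ := Real.exp (-(((m : ℝ) + 1) * L)) with hε
  have hε0 : 0 < ε := Real.exp_pos _
  have hqD : (q : ℝ) ^ D = Real.exp ((D : ℝ) * L) := by rw [Real.exp_nat_mul, hexpL]
  have hΛe : Λ ≤ Real.exp L := by rw [hexpL]; exact hΛq
  have h2Ke : (2 : ℝ) ^ K ≤ Real.exp L := by rw [hexpL]; exact h2Kq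
  have hΛ0 : 0 ≤ Λ := by linarith
  have hΛpos : 0 < Λ := by linarith
  have hiK : ((K : ℝ) * (m + 1) + D + 2) ≤ (i : ℝ) := by
    have : K * (m + 1) + D + 2 ≤ i := hKM ▸ hi1
    exact_mod_cast this
  have hexpi : Real.exp (-((i : ℝ) * L)) ≤ Real.exp (-(((K : ℝ) * (m + 1) + D + 2) * L)) := by
    rw [Real.exp_le_exp, neg_le_neg_iff]
    exact mul_le_mul_of_nonneg_right hiK hL0
  have hbudget : (q : ℝ) ^ D * Λ * Real.exp (-((i : ℝ) * L)) * (2 : ℝ) ^ K ≤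
      Real.exp (-((K : ℝ) * (((m : ℝ) + 1) * L))) := by
    calc (q : ℝ) ^ D * Λ * Real.exp (-((i : ℝ) * L)) * (2 : ℝ) ^ K
        ≤ Real.exp ((D : ℝ) * L) * Real.exp L *
            Real.exp (-(((K : ℝ) * (m + 1) + D + 2) * L)) * Real.exp L := by
          rw [hqD]; gcongr
      _ = Real.exp (-((K : ℝ) * (((m : ℝ) + 1) * L))) := by
          rw [← Real.exp_add, ← Real.exp_add, ← Real.exp_add]; congr 1; ring
  have hεK : Real.exp (-((K : ℝ) * (((m : ℝ) + 1) * L))) = ε ^ K := by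
    rw [hε, ← Real.exp_nat_mul]; congr 1; ring
  -- `‖w − y‖ < ε / 2`
  have hpowlt : ‖w - y‖ ^ K < (ε / 2) ^ K := by
    have h2 : (q : ℝ) ^ D * Λ * Real.exp (-((i : ℝ) * L)) ≤ ε ^ K / (2 : ℝ) ^ K := by
      rw [le_div_iff₀ (by positivity), ← hεK]; exact hbudget
    have h3 : ε ^ K / (2 : ℝ) ^ K = (ε / 2) ^ K := by rw [div_pow]
    have h6 : (q : ℝ) ^ D * Λ * |ℓ - r| < (q : ℝ) ^ D * Λ * Real.exp (-((i : ℝ) * L)) :=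
      mul_lt_mul_of_pos_left hη (by positivity)
    rw [← h3]
    exact lt_of_le_of_lt hpow (h6.trans_le h2)
  have hwy : ‖w - y‖ < ε / 2 := lt_of_pow_lt_pow_left₀ K (by positivity) hpowlt
  -- `|ℓ − r| < ε / 2`
  have hℓr : |ℓ - r| < ε / 2 := by
    refine hη.trans_le ?_
    have h2e : (2 : ℝ) ≤ Real.exp (((i : ℝ) - (m + 1)) * L) := by
      have h1 : (1 : ℝ) ≤ ((i : ℝ) - (m + 1)) * L := by
        have him : (1 : ℝ) ≤ (i : ℝ) - (m + 1) := by
          have h0 : ((m + 1 + 1 : ℕ) : ℝ) ≤ i := by exact_mod_cast hi2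
          push_cast at h0; linarith
        exact one_le_mul_of_one_le_of_one_le him hL1
      linarith [Real.add_one_le_exp (((i : ℝ) - (m + 1)) * L)]
    rw [hε, le_div_iff₀ (by norm_num : (0 : ℝ) < 2)]
    calc Real.exp (-((i : ℝ) * L)) * 2 ≤ Real.exp (-((i : ℝ) * L)) *
          Real.exp (((i : ℝ) - (m + 1)) * L) := mul_le_mul_of_nonneg_left h2e (Real.exp_pos _).le
      _ = Real.exp (-(((m : ℝ) + 1) * L)) := by rw [← Real.exp_add]; congr 1; ring
  -- `ε ≤ 1/q < ‖w‖`, so `y ≠ 0`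
  have hεq : ε ≤ 1 / q := by
    have h1 : ε ≤ Real.exp (-L) := by
      rw [hε, Real.exp_le_exp, neg_le_neg_iff]
      have : (0 : ℝ) ≤ (m : ℝ) * L := by positivity
      nlinarith
    refine h1.trans_eq ?_
    rw [Real.exp_neg, hexpL, one_div]
  have hy0 : y ≠ 0 := by
    intro hy0
    rw [hy0, sub_zero] at hwy
    linarith
  obtain ⟨f, hfirr, hfdeg, hfdegle, hfroot, hβ0, hfM⟩ := hβ r hr0
  refine ⟨q, hmq, f, specY G D r.num r.den, y, βof r, hfirr, hfdeg, hS0, hfroot, hy, hy0, hβ0,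
    by rw [hSdeg]; exact Nat.mul_le_mul_left K hfdegle, ?_, ?_, ?_⟩
  · -- `log M(S) ≤ c log q`
    have hMS := mahlerMeasure_specY_le G hD p q (by rw [← hp, ← hq] at hSdeg; exact hSdeg.le)
    have hMS1 := one_le_mahlerMeasure_int hS0
    have hRL0 : 0 < relLen G := by linarith
    have hK1 : (0 : ℝ) < (K : ℝ) + 1 := by linarith [(Nat.cast_nonneg K : (0 : ℝ) ≤ K)]
    calc Real.log ((specY G D r.num r.den).map (Int.castRingHom ℂ)).mahlerMeasure
        ≤ Real.log (((K : ℝ) + 1) * (relLen G * ((|p| : ℝ) + q) ^ D)) :=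
          Real.log_le_log (by linarith) hMS
      _ = Real.log ((K : ℝ) + 1) + Real.log (relLen G) + D * Real.log ((|p| : ℝ) + q) := by
          rw [Real.log_mul hK1.ne' (by positivity), Real.log_mul hRL0.ne' (by positivity),
            Real.log_pow]; ring
      _ ≤ Real.log ((K : ℝ) + 1) * L + Real.log (relLen G) * L + D * (A * L) := by
          gcongr ?_ + ?_ + ?_
          · exact le_mul_of_one_le_right hlK0 hL1
          · exact le_mul_of_one_le_right hlR0 hL1
          · exact mul_le_mul_of_nonneg_left hlogpq' (Nat.cast_nonneg D)
      _ ≤ c * L := by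
          have h0 : 0 ≤ A * L := by positivity
          have h0' : 0 ≤ Cβ * (A * L) := mul_nonneg hCβ h0
          have e : c * L = Real.log ((K : ℝ) + 1) * L + Real.log (relLen G) * L + D * (A * L) +
              A * L + Cβ * (A * L) := by
            rw [hc]; ring
          rw [e]; linarith
  · -- `log M(f) ≤ c log q`
    calc Real.log ((f.map (Int.castRingHom ℂ)).mahlerMeasure)
        ≤ Cβ * Real.log ((|p| : ℝ) + q) := by rw [hp, hq]; exact hfM
      _ ≤ Cβ * (A * L) := mul_le_mul_of_nonneg_left hlogpq' hCβ
      _ = (Cβ * A) * L := by ring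
      _ ≤ c * L := mul_le_mul_of_nonneg_right hAc hL0
  · -- the distance
    rw [hdist r, hwu]
    calc ‖w - y‖ + |ℓ - ↑r| < ε / 2 + ε / 2 := add_lt_add hwy hℓr
      _ = ε := by ring
      _ ≤ Real.exp (-((m : ℝ) * Real.log q)) := by
          rw [hε, Real.exp_le_exp, neg_le_neg_iff, ← hL]
          nlinarith

/-- The linear integer polynomial `q·X − p` of a rational `r = p/q` is irreducible. -/
private theorem irreducible_den_mul_X_sub_num' (r : ℚ) :
    Irreducible (C (r.den : ℤ) * X + C (-r.num) : ℤ[X]) := by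
  have hden : (r.den : ℤ) ≠ 0 := by exact_mod_cast r.den_ne_zero
  have hdeg : (C (r.den : ℤ) * X + C (-r.num) : ℤ[X]).degree = 1 := by
    rw [degree_add_eq_left_of_degree_lt] <;> rw [degree_C_mul_X hden]
    exact degree_C_le.trans_lt (by norm_num)
  have hprim : (C (r.den : ℤ) * X + C (-r.num) : ℤ[X]).IsPrimitive := by
    intro c hc
    rw [C_dvd_iff_dvd_coeff] at hc
    have h1 : c ∣ (r.den : ℤ) := by
      have := hc 1
      rwa [coeff_add, coeff_C_mul, coeff_X_one, mul_one, coeff_C, if_neg one_ne_zero,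
        add_zero] at this
    have h0 : c ∣ r.num := by
      have := hc 0
      rwa [coeff_add, coeff_C_mul, coeff_X_zero, mul_zero, zero_add, coeff_C_zero, dvd_neg] at this
    obtain ⟨u, v, huv⟩ := Rat.isCoprime_num_den r
    exact isUnit_of_dvd_one
      (huv ▸ dvd_add (dvd_mul_of_dvd_right h0 u) (dvd_mul_of_dvd_right h1 v))
  rw [hprim.irreducible_iff_irreducible_map_fraction_map (K := ℚ)]
  apply irreducible_of_degree_eq_one
  rwa [degree_map_eq_of_injective (algebraMap ℤ ℚ).injective_int]

/-- `q·X − p` has degree `1`, root `r`, and Mahler measure `max(|p|, q)`. -/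
private theorem linear_poly_facts (r : ℚ) :
    (C (r.den : ℤ) * X + C (-r.num) : ℤ[X]).natDegree = 1 ∧
      aeval ((r : ℝ) : ℂ) (C (r.den : ℤ) * X + C (-r.num) : ℤ[X]) = 0 ∧
      ((C (r.den : ℤ) * X + C (-r.num) : ℤ[X]).map (Int.castRingHom ℂ)).mahlerMeasure =
        max (|(r.num : ℝ)|) (r.den : ℝ) := by
  have hden : (r.den : ℤ) ≠ 0 := by exact_mod_cast r.den_ne_zero
  refine ⟨by rw [natDegree_add_C, natDegree_C_mul_X _ hden], ?_, ?_⟩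
  · rw [Complex.ofReal_ratCast, map_add, map_mul, aeval_X, aeval_C, aeval_C, algebraMap_int_eq,
      eq_intCast, eq_intCast, Int.cast_neg, Int.cast_natCast]
    have : (r : ℂ) * (r.den : ℂ) = (r.num : ℂ) := by exact_mod_cast Rat.mul_den_eq_num r
    linear_combination this
  · have hmap : (C (r.den : ℤ) * X + C (-r.num) : ℤ[X]).map (Int.castRingHom ℂ) =
        C (r.den : ℂ) * X + C (-(r.num : ℂ)) := by
      simp [Polynomial.map_add, Polynomial.map_mul]
    rw [hmap, mahlerMeasure_C_mul_X_add_C (by exact_mod_cast r.den_ne_zero), norm_neg,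
      Complex.norm_natCast, Complex.norm_intCast, max_comm]

/-- **ENGINE (the real instance): `ℓ` Liouville and `ℓ, e^ℓ` algebraically dependent ⇒
polynomial-quality simultaneous approximations of `(ℓ, e^ℓ)`** (`u = ℓ`, `β_r = r`, `f = qX − p`). -/
theorem liouvillePairApprox_of_dependent {ℓ : ℝ} (hℓ : Liouville ℓ)
    (hdep : ¬ AlgebraicIndependent ℚ ![(ℓ : ℂ), cexp ℓ]) : LiouvillePairApprox (ℓ : ℂ) := by
  refine liouvillePairApprox_of_dependent_gen hℓ rfl hdep (dβ := 1) (fun r => ((r : ℝ) : ℂ)) 2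
    (by norm_num) ?_ ?_
  · intro r hr0
    obtain ⟨hfdeg, hfroot, hfM⟩ := linear_poly_facts r
    refine ⟨C (r.den : ℤ) * X + C (-r.num), irreducible_den_mul_X_sub_num' r,
      by rw [hfdeg]; exact one_pos, hfdeg.le, hfroot,
      Complex.ofReal_ne_zero.mpr (by exact_mod_cast hr0), ?_⟩
    rw [hfM]
    have hq0 : (0 : ℝ) < r.den := by exact_mod_cast r.den_pos
    have hq1 : (1 : ℝ) ≤ r.den := by exact_mod_cast r.den_pos
    have h0 : (0 : ℝ) ≤ |(r.num : ℝ)| := abs_nonneg _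
    have h1 : Real.log (max (|(r.num : ℝ)|) (r.den : ℝ)) ≤ Real.log ((|r.num| : ℝ) + r.den) :=
      Real.log_le_log (lt_max_of_lt_right hq0) (max_le (by linarith) (by linarith))
    have h2 : 0 ≤ Real.log ((|r.num| : ℝ) + r.den) := Real.log_nonneg (by linarith)
    linarith
  · intro r
    rw [← Complex.ofReal_sub, Complex.norm_real, Real.norm_eq_abs]

end Summit.Schanuel.Schanuel.Theorems.RootDecomp1KSumFormBridge

end
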